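import Summits.NavierStokesRegularity.NavierStokesRegularity.Theorems.HeredityFromTwo.Negative.GlobalDesigns
import Literature.Analysis.FluidPDE.AxisymNoSwirlScaleInvariantBounds
import Literature.Analysis.FluidPDE.TaoQuantitativeClass
import Literature.Analysis.FluidPDE.NSEnstrophyPersistenceForced
import Literature.Analysis.FluidPDE.TaoH1APrioriForcedToolkit
import Literature.Analysis.FluidPDE.IsometryInvariance
import Literature.Analysis.FluidPDE.EnstrophySplitting

/-!
# The Gallay–Šverák speed cap BINDS the quiet era of every registered stage: the no-swirl cap lever
# against `HeredityAtOne` / `HeredityAt k` / `HeredityFrom k`, modulo the two printed GS15 facts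

Cell `ns-blowup`, seat `refuter-ns-palasek-19249-disprove-1` (DISPROVER on the route `PalasekTowerBreakdown`,
item stmt-NavierStokesRegularity-19249 `HeredityAtOne`). NEGATIVE-LANE lemmas; companion of
`HeredityAtOneFalseOfCappedStageAtOne.lean` (same seat: the cap as an abstract slot `WindowSpeedCap`).
Here the slot is DISCHARGED down to the tree's typed Gallay–Šverák facts (`AxisymNoSwirlScaleInvariantBounds`,
p446852: `GallaySverak2015.VelocitySupBound` = Prop. 2.6 (2.14), `GallaySverak2015.ImpulseConservation` =
Lemma 6.4, and the theorem `speedCap_of_facts` on Tao's class `IsTaoSolutionOn T 1`) by the BRIDGE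
`Stage ↦ IsTaoSolutionOn` on the quiet era, every link a theorem of the tree:

* a registered stage `s : Stage 1 R S m j` is a finite-energy classical solution of the design's forced
  system on `[0, τ_j]` from the Schwartz datum `S.u₀` under a Clay-class force, hence has ALL `L²` Sobolev
  norms bounded on `[0, τ_j]` (`IsClassicalNSSolutionOn.hasBoundedSobolevNormsOn_of_clayForce`, Tao 2013
  Cor. 4.3 + Thm. 5.4 (iv) with force — no boundedness or symmetry needed);
* translated to start at `τ_k`, `1 ≤ k < j`, the force VANISHES (`Schedule.Quiet`:
  `IsClassicalNSSolutionOn.translate_Icc_zero_anyForce` + `congr_force`), so the quiet-era flow is in the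
  tree's class `IsHkClassicalSolutionOn (Icc 0 (τ_j - τ_k))`, which carries a Tao-class pressure
  (`IsHkClassicalSolutionOn.exists_isTaoSolutionOn`, Tao 2021 §1 / Tao 2013 Thm. 5.4);
* `speedCap_of_facts` then bounds the speed on `[τ_k, τ_j]` by
  `C (∫η)^{1/4} (∫r²η)^{1/4} M^{1/2}` computed on the `τ_k`-slice (`η = ω_θ/r = angVortQuot`), whenever that
  slice is axisymmetric, swirl-free, with `0 ≤ η ≤ M`, `η` and `r²η` integrable
  (`stage_norm_le_noSwirlCap`).

Consequences (sorry-free; `C` = any constant validating the cap, `IsNoSwirlCapConstant C`; the GS facts give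
one, `exists_isNoSwirlCapConstant`, its size NOT explicit in print):
`not_heredityAt_of_noSwirlCappedStage` — ONE registered stage at a level `k ≥ 1` of a pinned rigid quiet
wide design whose `τ_k`-slice is single-signed swirl-free with `C (∫η)^{1/4}(∫r²η)^{1/4}M^{1/2} < c₁ Y_{k+1}`
refutes `HeredityAt k`; at `k = 1`: **`HeredityAtOne_false_of_NoSwirlCappedStageAtOne :
NoSwirlCappedStageAtOne → ¬ HeredityAtOne`** (route decl; `H` = such a constant-and-stage pair);
`not_heredityFrom_of_noSwirlSignedStage` — against `HeredityFrom k` the constant is irrelevant: one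
registered stage at a level `k ≥ 1` with single-signed swirl-free integrable `τ_k`-slice refutes it
(modulo the two GS facts only), because `Y → ∞` on the same design (KJ-11's
`HeredityFrom.nonempty_stage_of_le`, p446929).

WHAT THIS IS NOT: not Navier–Stokes evidence — no stage is constructed; `NoSwirlCappedStageAtOne` is OPEN
(a registered level-1 stage is `EpisodeBaseG`-type; the cell's swirl-free ring numerics reach
`ρ* ≤ 1.42 < 2.056 = Y₁/Y₀`), and for item 19249 ALONE the cap must be tight within `Y₂/Y₁ ≈ 2.21` on the
level-1 slice (thin ring: ratio `2√π C/κ ≈ (3.5–5.5) C`, so only if `C ≲ 0.4–0.6`). No verdict changes.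

References: T. Gallay, V. Šverák, Confluentes Math. 7 (2015/16) = arXiv:1510.01036, Prop. 2.6, Lemma 5.1,
Lemma 6.4 [cite: GallaySverak2016, Prop. 2.6]; T. Tao, Anal. PDE 6 (2013), Cor. 4.3, Thm. 5.4
[cite: Tao2011, Cor. 4.3 + Thm. 5.4 (iv)]; S. Palasek, arXiv:2605.13827 §4 [cite: Palasek2026ElementaryModel, §4].
-/

noncomputable section

namespace Summit.NavierStokesRegularity.HeredityAtOneNoSwirlCap

open Set MeasureTheory Filter Topology Function
open scoped ENNReal ContDiff NNReal
open Literature.Analysis.FluidPDE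
open Summit.NavierStokesRegularity.FluidComputer.PalasekTowerClayBridge
open Summit.NavierStokesRegularity.NavierStokesRegularity

/-! ## §1 The cap constant and the single-signed swirl-free slice class -/

/-- **`C` validates the Gallay–Šverák all-time speed cap** on Tao's class (the conclusion of
`speedCap_of_facts`, with the constant named): for every Tao-class solution `(u, p)` of the unforced
unit-viscosity system on `[0, T]` from an axisymmetric swirl-free datum with `0 ≤ η₀ ≤ M`
(`η₀ = ω_θ/r = angVortQuot u₀`), `η₀` and `r²η₀` integrable,
`‖u(t, x)‖ ≤ C √(√((∫η₀)(∫r²η₀)) M)` on `[0, T]`. [cite: GallaySverak2016, Prop. 2.6] -/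
def IsNoSwirlCapConstant (C : ℝ) : Prop :=
  0 ≤ C ∧
    ∀ ⦃T : ℝ⦄ ⦃u₀ : EuclideanSpace ℝ (Fin 3) → EuclideanSpace ℝ (Fin 3)⦄
      ⦃u : ℝ → EuclideanSpace ℝ (Fin 3) → EuclideanSpace ℝ (Fin 3)⦄
      ⦃p : ℝ → EuclideanSpace ℝ (Fin 3) → ℝ⦄ ⦃M : ℝ⦄,
      0 < T → IsTaoSolutionOn T 1 u₀ u p → IsAxisymmetric u₀ → HasNoSwirl u₀ →
      (∀ x, 0 ≤ angVortQuot u₀ x) → (∀ x, angVortQuot u₀ x ≤ M) →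
      Integrable (angVortQuot u₀) → Integrable (fun x => cylRadius x ^ 2 * angVortQuot u₀ x) →
      ∀ t ∈ Icc 0 T, ∀ x,
        ‖u t x‖ ≤ C * Real.sqrt (Real.sqrt ((∫ y, angVortQuot u₀ y) *
          ∫ y, cylRadius y ^ 2 * angVortQuot u₀ y) * M)

/-- **The two printed GS15 facts give a cap constant** (`speedCap_of_facts`, p446852).
[cite: GallaySverak2016, Prop. 2.6 (2.14), Lemma 6.4] -/
theorem exists_isNoSwirlCapConstant (hBS : GallaySverak2015.VelocitySupBound)
    (hI : GallaySverak2015.ImpulseConservation) : ∃ C, IsNoSwirlCapConstant C := by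
  obtain ⟨C, hC0, hC⟩ := speedCap_of_facts hBS hI
  exact ⟨C, hC0, hC⟩

/-- **Single-signed swirl-free slice with height `M`**: axisymmetric, no swirl, `0 ≤ ω_θ/r ≤ M`,
`ω_θ/r` and `r² ω_θ/r` integrable (finite `L¹(Ω)` norm and finite impulse). [cite: GallaySverak2016, Thm. 1.1] -/
structure SignedNoSwirlSlice (v : EuclideanSpace ℝ (Fin 3) → EuclideanSpace ℝ (Fin 3)) (M : ℝ) :
    Prop where
  axisym : IsAxisymmetric v
  noSwirl : HasNoSwirl v
  nonneg : ∀ x, 0 ≤ angVortQuot v x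
  le : ∀ x, angVortQuot v x ≤ M
  integrable : Integrable (angVortQuot v)
  integrable_sq : Integrable (fun x => cylRadius x ^ 2 * angVortQuot v x)

/-! ## §2 The bridge: the quiet era of a registered stage is in Tao's class, so the cap binds it -/

section Bridge

variable {R : TowerRates} {S : Schedule R} {m : Margins R}

/-- `‖g‖_{L²} ≤ max 1 C` from `∫⁻ ‖g‖ₑ² ≤ C`. [folklore] -/
theorem eLpNorm_two_le_max_of_lintegral_sq_le {α : Type*} [MeasurableSpace α] {μ : Measure α}
    {G : Type*} [NormedAddCommGroup G] {g : α → G} {C : ℝ≥0} (h : ∫⁻ x, ‖g x‖ₑ ^ 2 ∂μ ≤ C) :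
    eLpNorm g 2 μ ≤ ((max 1 C : ℝ≥0) : ℝ≥0∞) := by
  rw [lintegral_enorm_sq_eq_eLpNorm_two_sq] at h
  rcases le_or_gt (eLpNorm g 2 μ) 1 with h1 | h1
  · exact h1.trans (by exact_mod_cast le_max_left 1 C)
  · calc eLpNorm g 2 μ ≤ eLpNorm g 2 μ * eLpNorm g 2 μ := le_mul_of_one_le_left bot_le h1.le
      _ = eLpNorm g 2 μ ^ 2 := (sq _).symm
      _ ≤ C := h
      _ ≤ ((max 1 C : ℝ≥0) : ℝ≥0∞) := by exact_mod_cast le_max_right 1 C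

/-- **A registered stage has all `L²` Sobolev norms bounded on its slab** (any rates, margins, level;
unit viscosity): it is a finite-energy classical solution from the Schwartz datum `S.u₀` under the
Clay-class design force (`IsClassicalNSSolutionOn.hasBoundedSobolevNormsOn_of_clayForce`). [cite: Tao2011, Cor. 4.3 + Thm. 5.4 (iv)] -/
theorem stage_hasBoundedSobolevNormsOn {j : ℕ} (s : Stage 1 R S m j) :
    HasBoundedSobolevNormsOn (Icc 0 (S.τ j)) s.u := by
  have hE : ∃ C : ℝ≥0, ∀ t ∈ Icc 0 (S.τ j), ∫⁻ x, ‖s.u t x‖ₑ ^ 2 ≤ C := by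
    obtain ⟨C, hC, hb⟩ := s.energy
    exact ⟨C.toNNReal, fun t ht => (hb t ht).trans (ENNReal.coe_toNNReal hC.ne).ge⟩
  have h₀ : HasRapidSpatialDecay (s.u 0) := by
    rw [s.initial]
    exact S.datum_decay
  exact s.classical.hasBoundedSobolevNormsOn_of_clayForce one_pos (S.τ_pos j) hE h₀ S.force_smooth
    S.force_decay

/-- **The quiet era of a registered stage is in the tree's Tao 2021 class**: for a quiet design and
levels `1 ≤ k < j`, the flow `t ↦ u(t + τ_k)` of a registered level-`j` stage is an UNFORCED classical
solution on `[0, τ_j - τ_k]` with all `L²` Sobolev norms bounded. [cite: Tao2011, Cor. 4.3 + Thm. 5.4 (iv)] -/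
theorem stage_isHkClassicalSolutionOn_quiet (hQ : S.Quiet) {k j : ℕ} (hk : 1 ≤ k) (hkj : k < j)
    (s : Stage 1 R S m j) :
    IsHkClassicalSolutionOn (Icc 0 (S.τ j - S.τ k)) (fun t => s.u (t + S.τ k))
      (fun t => s.p (t + S.τ k)) := by
  have hτ : S.τ k < S.τ j := S.τ_strictMono hkj
  have htr := s.classical.translate_Icc_zero_anyForce (S.τ_pos k).le hτ
  refine ⟨htr.congr_force fun t ht x => ?_, fun n => ?_⟩
  · have h0 : S.f (t + S.τ k) = 0 := hQ (t + S.τ k) (by linarith [ht.1, S.τ_mono hk])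
    simp [h0]
  · obtain ⟨C, hC⟩ := stage_hasBoundedSobolevNormsOn s n
    exact ⟨max 1 C, fun t ht =>
      eLpNorm_two_le_max_of_lintegral_sq_le (hC (t + S.τ k) ⟨by linarith [ht.1, S.τ_pos k],
        by linarith [ht.2]⟩)⟩

/-- **THE CAP BINDS THE QUIET ERA OF EVERY REGISTERED STAGE**: if `C` validates the cap, the design is
quiet, `1 ≤ k < j`, and the `τ_k`-slice of a registered level-`j` stage is single-signed swirl-free with
height `M`, then `‖u(t, x)‖ ≤ C √(√((∫η)(∫r²η)) M)` (computed on the `τ_k`-slice) for ALL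
`t ∈ [τ_k, τ_j]` and all `x`. [cite: GallaySverak2016, Prop. 2.6] -/
theorem stage_norm_le_noSwirlCap {C : ℝ} (hC : IsNoSwirlCapConstant C) (hQ : S.Quiet) {k j : ℕ}
    (hk : 1 ≤ k) (hkj : k < j) (s : Stage 1 R S m j) {M : ℝ}
    (hsl : SignedNoSwirlSlice (s.u (S.τ k)) M) :
    ∀ t ∈ Icc (S.τ k) (S.τ j), ∀ x,
      ‖s.u t x‖ ≤ C * Real.sqrt (Real.sqrt ((∫ y, angVortQuot (s.u (S.τ k)) y) *
        ∫ y, cylRadius y ^ 2 * angVortQuot (s.u (S.τ k)) y) * M) := by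
  intro t ht x
  have hτ : S.τ k < S.τ j := S.τ_strictMono hkj
  obtain ⟨q, hTao⟩ := (stage_isHkClassicalSolutionOn_quiet hQ hk hkj s).exists_isTaoSolutionOn (sub_pos.2 hτ)
  simp only [zero_add] at hTao
  have hb := hC.2 (sub_pos.2 hτ) hTao hsl.axisym hsl.noSwirl hsl.nonneg hsl.le hsl.integrable
    hsl.integrable_sq (t - S.τ k) ⟨by linarith [ht.1], by linarith [ht.2]⟩ x
  simpa only [sub_add_cancel] using hb

end Bridge

/-! ## §3 The lever -/

/-- **The no-swirl cap lever at level `k ≥ 1`**: a cap constant `C`, a pinned rigid quiet wide design,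
ONE registered level-`k` stage whose `τ_k`-slice is single-signed swirl-free with height `M` and cap
value `C √(√((∫η)(∫r²η)) M) < c₁ Y_{k+1}` refute `HeredityAt k` — the extension stage agrees with the
stage at `τ_k` (`Stage.Extends`), is capped on `[τ_k, τ_{k+1}]` (§2), and misses its floor at
`τ_{k+1}`. [cite: Palasek2026ElementaryModel, §4] -/
theorem not_heredityAt_of_noSwirlCappedStage {k : ℕ} (hk : 1 ≤ k) {C : ℝ} (hC : IsNoSwirlCapConstant C)
    {S : Schedule TowerRates.wide} (hP : S.Pins 8 (6 / 5)) (hR : S.Rigid) (hQ : S.Quiet)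
    (s : Stage 1 TowerRates.wide S (Margins.routeG TowerRates.wide) k) {M : ℝ}
    (hsl : SignedNoSwirlSlice (s.u (S.τ k)) M)
    (hlt : C * Real.sqrt (Real.sqrt ((∫ y, angVortQuot (s.u (S.τ k)) y) *
        ∫ y, cylRadius y ^ 2 * angVortQuot (s.u (S.τ k)) y) * M) <
      S.c₁ * TowerRates.wide.Y (k + 1)) :
    ¬ HeredityAt k := by
  intro h
  obtain ⟨s', hs'⟩ := h S hP hR hQ s
  have hk0 : s'.u (S.τ k) = s.u (S.τ k) := (hs' (S.τ k) ⟨(S.τ_pos k).le, le_rfl⟩).1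
  have hsl' : SignedNoSwirlSlice (s'.u (S.τ k)) M := by rw [hk0]; exact hsl
  obtain ⟨x, -, hfl⟩ := s'.floor (k + 1) le_rfl
  have hle := stage_norm_le_noSwirlCap hC hQ hk (Nat.lt_succ_self k) s' hsl' (S.τ (k + 1))
    ⟨(S.τ_lt_succ k).le, le_rfl⟩ x
  rw [hk0] at hle
  linarith

/-- **Witness class `H_GS(1)` by name** (hypothesis, never asserted; the `H` of the negative lemma below):
a constant validating the Gallay–Šverák cap AND one registered LEVEL-1 stage of a pinned (`Λ = 8`,
`θ = 6/5`) rigid quiet wide design whose `τ₁`-slice is single-signed swirl-free with cap value below the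
level-2 floor `c₁ Y₂`. OPEN: the GS facts give a constant of unknown size; no registered level-1 stage is
known in any class. [cite: Palasek2026ElementaryModel, §4] -/
@[conjecture] def NoSwirlCappedStageAtOne : Prop :=
  ∃ C : ℝ, IsNoSwirlCapConstant C ∧
    ∃ (S : Schedule TowerRates.wide) (s : Stage 1 TowerRates.wide S (Margins.routeG TowerRates.wide) 1)
      (M : ℝ), S.Pins 8 (6 / 5) ∧ S.Rigid ∧ S.Quiet ∧ SignedNoSwirlSlice (s.u (S.τ 1)) M ∧
      C * Real.sqrt (Real.sqrt ((∫ y, angVortQuot (s.u (S.τ 1)) y) *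
          ∫ y, cylRadius y ^ 2 * angVortQuot (s.u (S.τ 1)) y) * M) <
        S.c₁ * TowerRates.wide.Y 2

/-- **`H_GS(1) → ¬ HeredityAtOne`** — the T2 supplement's lever (b) at `j = 1` with the cap DISCHARGED to
the printed GS15 facts: modulo `VelocitySupBound ∧ ImpulseConservation` (which supply the constant),
ONE registered single-signed swirl-free level-1 stage with small enough cap value refutes the item.
[cite: GallaySverak2016, Prop. 2.6] -/
theorem HeredityAtOne_false_of_NoSwirlCappedStageAtOne :
    NoSwirlCappedStageAtOne → ¬ Theses.PalasekTowerBreakdown.HeredityAtOne := by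
  rintro ⟨C, hC, S, s, M, hP, hR, hQ, hsl, hlt⟩ h
  exact not_heredityAt_of_noSwirlCappedStage le_rfl hC hP hR hQ s hsl hlt (heredityAtOne_iff.1 h)

/-- **Against `HeredityFrom k` the constant is irrelevant** (modulo a cap constant, i.e. the two GS15
facts): ONE registered stage at a level `k ≥ 1` of a pinned rigid quiet wide design whose `τ_k`-slice is
single-signed swirl-free (any height, integrable) refutes `HeredityFrom k` — heredity inside the design
reaches a level `k + j + 1` whose floor `c₁ Y_{k+j+1}` exceeds the cap value frozen at `τ_k`
(`TowerRates.tendsto_Y_atTop`), and that stage agrees with the given one at `τ_k`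
(`Stage.velocity_eq_of_le'`). [cite: Palasek2026ElementaryModel, §4] -/
theorem not_heredityFrom_of_noSwirlSignedStage {k : ℕ} (hk : 1 ≤ k) {C : ℝ}
    (hC : IsNoSwirlCapConstant C) {S : Schedule TowerRates.wide} (hP : S.Pins 8 (6 / 5))
    (hR : S.Rigid) (hQ : S.Quiet) (s : Stage 1 TowerRates.wide S (Margins.routeG TowerRates.wide) k)
    {M : ℝ} (hsl : SignedNoSwirlSlice (s.u (S.τ k)) M) : ¬ HeredityFrom k := by
  intro h
  set Φ : ℝ := C * Real.sqrt (Real.sqrt ((∫ y, angVortQuot (s.u (S.τ k)) y) *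
    ∫ y, cylRadius y ^ 2 * angVortQuot (s.u (S.τ k)) y) * M) with hΦ
  obtain ⟨j, hj⟩ := ((TowerRates.wide.tendsto_Y_atTop.comp (tendsto_add_atTop_nat (k + 1))).eventually
    (eventually_gt_atTop (Φ / S.c₁))).exists
  have hj' : Φ / S.c₁ < TowerRates.wide.Y (k + (j + 1)) := by
    simpa [Function.comp, add_comm, add_left_comm, add_assoc] using hj
  have hlt : Φ < S.c₁ * TowerRates.wide.Y (k + (j + 1)) := by
    have := (div_lt_iff₀ S.c₁_pos).1 hj'
    linarith [mul_comm (TowerRates.wide.Y (k + (j + 1))) S.c₁]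
  have hkk : k < k + (j + 1) := Nat.lt_add_of_pos_right (Nat.succ_pos j)
  obtain ⟨s'⟩ := h.nonempty_stage_of_le hP hR hQ s hkk.le
  have hk0 : s'.u (S.τ k) = s.u (S.τ k) :=
    Stage.velocity_eq_of_le' one_pos hkk.le s s' (S.τ k) ⟨(S.τ_pos k).le, le_rfl⟩
  have hsl' : SignedNoSwirlSlice (s'.u (S.τ k)) M := by rw [hk0]; exact hsl
  obtain ⟨x, -, hfl⟩ := s'.floor (k + (j + 1)) le_rfl
  have hle := stage_norm_le_noSwirlCap hC hQ hk hkk s' hsl' (S.τ (k + (j + 1)))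
    ⟨(S.τ_strictMono hkk).le, le_rfl⟩ x
  rw [hk0, ← hΦ] at hle
  linarith

/-- The same against the route's PARENT decl `EpisodeInduction` (`= HeredityFrom 1`): modulo a cap
constant, one registered single-signed swirl-free stage at any level `k ≥ 1` refutes it.
[cite: Palasek2026ElementaryModel, §4] -/
theorem episodeInduction_false_of_noSwirlSignedStage {k : ℕ} (hk : 1 ≤ k) {C : ℝ}
    (hC : IsNoSwirlCapConstant C) {S : Schedule TowerRates.wide} (hP : S.Pins 8 (6 / 5))
    (hR : S.Rigid) (hQ : S.Quiet) (s : Stage 1 TowerRates.wide S (Margins.routeG TowerRates.wide) k)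
    {M : ℝ} (hsl : SignedNoSwirlSlice (s.u (S.τ k)) M) :
    ¬ Theses.PalasekTowerBreakdown.EpisodeInduction := fun h =>
  not_heredityFrom_of_noSwirlSignedStage hk hC hP hR hQ s hsl
    ((episodeInductionG_iff_heredityFrom_one.1 h).mono hk)

/-- **Dichotomy** (modulo the two GS15 facts): the two heredity items jointly FORBID a single-signed
swirl-free integrable `τ_k`-slice on any registered stage at any level `k ≥ 1` of a pinned rigid quiet
wide design. [cite: GallaySverak2016, Prop. 2.6] -/
theorem not_signedNoSwirlSlice_of_heredity (hBS : GallaySverak2015.VelocitySupBound)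
    (hI : GallaySverak2015.ImpulseConservation) (h₁ : HeredityAtOne) (h₂ : HeredityFrom 2)
    {S : Schedule TowerRates.wide} (hP : S.Pins 8 (6 / 5)) (hR : S.Rigid) (hQ : S.Quiet) {k : ℕ}
    (hk : 1 ≤ k) (s : Stage 1 TowerRates.wide S (Margins.routeG TowerRates.wide) k) (M : ℝ) :
    ¬ SignedNoSwirlSlice (s.u (S.τ k)) M := fun hsl => by
  obtain ⟨C, hC⟩ := exists_isNoSwirlCapConstant hBS hI
  exact not_heredityFrom_of_noSwirlSignedStage hk hC hP hR hQ s hsl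
    ((HeredityAt.heredityFrom (heredityAtOne_iff.1 h₁) h₂).mono hk)

end Summit.NavierStokesRegularity.HeredityAtOneNoSwirlCap

end
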